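import Mathlib
import Summits.AtomisticToContinuum.HydrodynamicLimit.Theorems.ImplosionDichotomyDenseExcursionPackingResolventFarField
import Literature.Analysis.ODE.BarrierTouching

/-!
# The far field of the packing-resolvent gain: the `s`-component keeps the gain `1/Λ` where `S → 0`
# (crux `DenseExcursion`, stmt-AtomisticToContinuum-12586, line `sonic-cavity-renewal` v8, stub `stub_packingResolventW`)

Helper file (`--supports stmt-AtomisticToContinuum-12586`) for the registered stub `stub_packingResolventW` (skeleton v8;
registered helper here: `packingResolventW_farFieldQ`). The characteristic barriers `P̄, M̄ ≍ (N/Λ)(1 + S)` of the outer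
region bound `u₁` and `u₂` SEPARATELY by `O(N/Λ)`; the weighted quantity `q = u₂/S` of the gain norm needs one more
step where `S → 0` (`x → +∞`): in the far-field variables of the landed `farField_cramer`,
`q′ = A₂₁u₁ + A₂₂q + g₂` with `A₂₂ ≤ −Λ/2 + 9/2`, `|A₂₁| ≤ (2/3)Λ + 9`, `|g₂| ≤ 4N` on a window `x ≥ X` where the profile is
`1/2`-close to its far-field limit (`S ≤ 1/2`, `|W| ≤ 1/2`, `|W′| ≤ 1`, `|S′/S + r| ≤ 1`, `(W−1)² − S² ≥ 1/2`,
`(W − 1)/((W−1)² − S²) ≤ −1/2`). The touching lemma (`Literature.Analysis.ODE.barrier_touching'`) with the barrier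
`Q + η′eˣ` (the `η′`-term makes the gauge supremum attained on `[X, ∞)`; `η′ → 0` at the end) then gives, for `Λ ≥ 100`,
`|q| ≤ 2A + 10N/Λ + Q₀` on `x ≥ X` from `|u₁| ≤ A` there and the inflow datum `|q(X)| ≤ Q₀` — with `A, Q₀ = O(N/Λ)` from the
outer barriers this is the far-field part of the `(1 + S)`-weighted gain.
-/

noncomputable section

open Set Filter Topology

namespace Summit.AtomisticToContinuum.HydrodynamicLimit.Theorems.PackingAnalyticImplosion

/-- THE FAR-FIELD COEFFICIENT BOUNDS on the `1/2`-window: `−A₂₂ ≥ Λ/2 − 9/2`, `|A₂₁| ≤ (2/3)Λ + 9`, and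
`|g₂| ≤ 4N` for `|F| ≤ N(1 + b)`, `|H| ≤ Nb` (notation of `farField_cramer`, `σ = b′/b`). [folklore] -/
theorem farField_q_coeffs {Λ r a a' b σ F H N : ℝ} (hΛ : 100 ≤ Λ) (hr1 : 1 ≤ r) (hr2 : r ≤ 2) (hb : 0 < b) (hb2 : b ≤ 1 / 2)
    (ha : |a| ≤ 1 / 2) (ha' : |a'| ≤ 1) (hσ : |σ + r| ≤ 1) (hD : 1 / 2 ≤ (a - 1) ^ 2 - b ^ 2)
    (hneg : (a - 1) / ((a - 1) ^ 2 - b ^ 2) ≤ -(1 / 2)) (hN : 0 ≤ N) (hF : |F| ≤ N * (1 + b)) (hH : |H| ≤ N * b) :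
    Λ / 2 - 9 / 2 ≤ -((2 * (σ + 1) * b ^ 2 + (a - 1) * (Λ + r - a' / 3 - 2 * a - (a - 1) * σ)) / ((a - 1) ^ 2 - b ^ 2)) ∧
    |(-(1 / 3) * (Λ + r - a' - 2 * a) - (a - 1) * (σ + 2)) / ((a - 1) ^ 2 - b ^ 2)| ≤ 2 / 3 * Λ + 9 ∧
    |1 / 3 / ((a - 1) ^ 2 - b ^ 2) * F + -(a - 1) / ((a - 1) ^ 2 - b ^ 2) * (H / b)| ≤ 4 * N := by
  obtain ⟨hal, hau⟩ := abs_le.1 ha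
  obtain ⟨ha'l, ha'u⟩ := abs_le.1 ha'
  obtain ⟨hσl, hσu⟩ := abs_le.1 hσ
  set D : ℝ := (a - 1) ^ 2 - b ^ 2 with hD_def
  have hDpos : 0 < D := by linarith
  have hD1 : 1 / D ≤ 2 := by rw [div_le_iff₀ hDpos]; linarith
  refine ⟨?_, ?_, ?_⟩
  · -- `A₂₂ ≤ 2 − K/2`, `K ≥ Λ − 5`
    set K : ℝ := Λ + r - a' / 3 - 2 * a - (a - 1) * σ with hK
    have hK0 : Λ - 5 ≤ K := by rw [hK]; nlinarith
    have hKpos : 0 ≤ K := by linarith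
    have h1 : (a - 1) * K / D ≤ -(1 / 2) * K := by
      rw [mul_div_right_comm]
      exact mul_le_mul_of_nonneg_right hneg hKpos
    have h2 : |2 * (σ + 1) * b ^ 2 / D| ≤ 2 := by
      rw [abs_div, abs_of_pos hDpos, div_le_iff₀ hDpos]
      have : |2 * (σ + 1) * b ^ 2| ≤ 1 := by
        rw [abs_mul, abs_mul, abs_of_pos (by norm_num : (0:ℝ) < 2), abs_of_nonneg (by positivity : (0:ℝ) ≤ b ^ 2)]
        have hb4 : b ^ 2 ≤ 1 / 4 := by nlinarith
        have hs : |σ + 1| ≤ 2 := by rw [abs_le]; constructor <;> linarith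
        calc 2 * |σ + 1| * b ^ 2 ≤ 2 * 2 * (1 / 4) := by
              apply mul_le_mul (by linarith) hb4 (by positivity) (by positivity)
          _ = 1 := by norm_num
      linarith
    obtain ⟨-, h2u⟩ := abs_le.1 h2
    have e1 : (2 * (σ + 1) * b ^ 2 + (a - 1) * K) / D = 2 * (σ + 1) * b ^ 2 / D + (a - 1) * K / D := by
      rw [add_div]
    rw [e1]
    linarith
  · rw [abs_div, abs_of_pos hDpos, div_le_iff₀ hDpos]
    have h1 : |(-(1 / 3) * (Λ + r - a' - 2 * a) - (a - 1) * (σ + 2))| ≤ Λ / 3 + 9 / 2 := by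
      rw [abs_le]; constructor <;> nlinarith
    nlinarith
  · have t1 : |1 / 3 / D * F| ≤ (1 / 3 * 2) * (N * (1 + b)) := by
      rw [abs_mul, abs_of_pos (by positivity : (0:ℝ) < 1 / 3 / D)]
      refine mul_le_mul ?_ hF (abs_nonneg _) (by positivity)
      rw [div_div]; rw [div_le_iff₀ (by positivity)]; nlinarith
    have t2 : |-(a - 1) / D * (H / b)| ≤ (3 / 2 * 2) * N := by
      rw [abs_mul]
      have h1 : |-(a - 1) / D| ≤ 3 / 2 * 2 := by
        rw [abs_div, abs_of_pos hDpos, div_le_iff₀ hDpos, abs_neg]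
        have : |a - 1| ≤ 3 / 2 := by rw [abs_le]; constructor <;> linarith
        nlinarith
      have h2 : |H / b| ≤ N := by
        rw [abs_div, abs_of_pos hb, div_le_iff₀ hb]; exact hH
      exact mul_le_mul h1 h2 (abs_nonneg _) (by norm_num)
    calc _ ≤ |1 / 3 / D * F| + |-(a - 1) / D * (H / b)| := abs_add_le _ _
      _ ≤ (1 / 3 * 2) * (N * (1 + b)) + (3 / 2 * 2) * N := add_le_add t1 t2
      _ ≤ 4 * N := by nlinarith

/-- A bound `a ≤ b + η′c` valid for every `η′ > 0` (with `c ≥ 0`) gives `a ≤ b`. [folklore] -/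
theorem le_of_forall_eta {a b c : ℝ} (hc : 0 ≤ c) (h : ∀ η' : ℝ, 0 < η' → a ≤ b + η' * c) : a ≤ b := by
  rcases eq_or_lt_of_le hc with h0 | h0
  · have := h 1 one_pos
    rw [← h0, mul_zero, add_zero] at this
    exact this
  · by_contra hcon
    push Not at hcon
    have h1 := h ((a - b) / (2 * c)) (by apply div_pos <;> linarith)
    have h2 : (a - b) / (2 * c) * c = (a - b) / 2 := by field_simp
    rw [h2] at h1
    linarith

/-- **Registered helper `packingResolventW_farFieldQ` of `stub_packingResolventW`: THE FAR-FIELD BOUND OF `q = u₂/S`.**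
For `Λ ≥ 100`, a differentiable real solution `(u₁, u₂)` of the real resolvent system whose `u₁` is bounded by `A` and whose
`(1 + S)`-weighted source has size `N` on the far-field window `x ≥ X` of the profile, with `u₂/S` globally bounded and
`|u₂(X)/S(X)| ≤ Q₀`: `|u₂/S| ≤ 2A + 10N/Λ + Q₀` on `x ≥ X` (touching lemma for the `q`-equation of `farField_cramer`,
barrier `2A + 10N/Λ + Q₀ + η′eˣ`, `η′ → 0`). [folklore] -/
theorem packingResolventW_farFieldQ : ∀ (r Λ X A Q₀ N N' : ℝ) (W S u₁ u₂ f₁ f₂ : ℝ → ℝ), 100 ≤ Λ → 1 ≤ r → r ≤ 2 → 0 ≤ A → 0 ≤ Q₀ → 0 < N → Differentiable ℝ S → (∀ x, 0 < S x) → Differentiable ℝ u₁ → Differentiable ℝ u₂ → (∀ x, X ≤ x → S x ≤ 1 / 2 ∧ |W x| ≤ 1 / 2 ∧ |deriv W x| ≤ 1 ∧ |deriv S x / S x + r| ≤ 1 ∧ 1 / 2 ≤ (W x - 1) ^ 2 - S x ^ 2 ∧ (W x - 1) / ((W x - 1) ^ 2 - S x ^ 2) ≤ -(1 / 2)) → (∀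 x, Λ * u₁ x - ((W x - 1) * deriv u₁ x + 3 * S x * deriv u₂ x + (deriv W x + 2 * W x - r) * u₁ x + (3 * deriv S x + 6 * S x) * u₂ x) = f₁ x ∧ Λ * u₂ x - (S x / 3 * deriv u₁ x + (W x - 1) * deriv u₂ x + (deriv S x + 2 * S x) * u₁ x + (deriv W x / 3 + 2 * W x - r) * u₂ x) = f₂ x) → (∀ x, X ≤ x → |u₁ x| ≤ A) → (∀ x, X ≤ x → |f₁ x| ≤ N * (1 + S x) ∧ |f₂ x| ≤ N * S x) → (∀ x, |u₂ x / S x| ≤ N') → |u₂ X / S X| ≤ Q₀ → ∀ x, X ≤ x → |u₂ x / S x| ≤ 2 * A + 10 * N / Λ + Q₀ := by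
  intro r Λ X A Q₀ N N' W S u₁ u₂ f₁ f₂ hΛ hr1 hr2 hA hQ₀ hN hSd hSpos hu₁ hu₂ hwin heq hu₁A hsrc hqN' hq0 x₀ hx₀
  have hΛpos : 0 < Λ := by linarith
  set Q : ℝ := 2 * A + 10 * N / Λ + Q₀ with hQ_def
  have hQpos : 0 < Q := by rw [hQ_def]; positivity
  set q : ℝ → ℝ := fun x => u₂ x / S x with hq_def
  -- for every `η′ > 0`: `|q x₀| ≤ Q + η′ e^{x₀}`
  refine le_of_forall_eta (Real.exp_pos x₀).le fun η' hη' => ?_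
  set Qb : ℝ → ℝ := fun x => Q + η' * Real.exp x with hQb_def
  have hQbpos : ∀ x, 0 < Qb x := fun x => by simp only [hQb_def]; positivity
  -- the gauge and its maximum on `[X, ∞)`
  set g : ℝ → ℝ := fun x => |q x| / Qb x with hg_def
  have hqc : Continuous q := by
    simp only [hq_def]
    exact hu₂.continuous.div hSd.continuous fun x => (hSpos x).ne'
  have hgc : Continuous g := by
    simp only [hg_def, hQb_def]
    exact hqc.abs.div (by fun_prop) fun x => (hQbpos x).ne'
  have hg0 : ∀ x ∈ Ici X, 0 ≤ g x := fun x _ => by simp only [hg_def]; positivity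
  have hglim : Tendsto g atTop (𝓝 0) := by
    -- `g ≤ N' / (η′ eˣ) → 0`
    have hN'0 : 0 ≤ N' := le_trans (abs_nonneg _) (hqN' 0)
    have h1 : Tendsto (fun x => N' / (η' * Real.exp x)) atTop (𝓝 0) := by
      have h2 : Tendsto (fun x => η' * Real.exp x) atTop atTop := Real.tendsto_exp_atTop.const_mul_atTop hη'
      have h3 := h2.inv_tendsto_atTop.const_mul N'
      rw [mul_zero] at h3
      exact h3.congr fun x => by simp [div_eq_mul_inv]
    refine squeeze_zero (fun x => by simp only [hg_def]; positivity) (fun x => ?_) h1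
    simp only [hg_def, hQb_def]
    calc |q x| / (Q + η' * Real.exp x) ≤ N' / (Q + η' * Real.exp x) :=
          div_le_div_of_nonneg_right (hqN' x) (by positivity)
      _ ≤ N' / (η' * Real.exp x) := by
          apply div_le_div_of_nonneg_left hN'0 (by positivity); linarith
  obtain ⟨xs, hxsX, hmax⟩ := Literature.Analysis.ODE.exists_isMaxOn_Ici_of_tendsto_zero hgc.continuousOn hg0 hglim
  set θ : ℝ := g xs with hθ_def
  have hθ0 : 0 ≤ θ := hg0 xs hxsX
  have hle : ∀ x, X ≤ x → |q x| ≤ θ * Qb x := fun x hx => by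
    have h1 : g x ≤ θ := hmax hx
    simp only [hg_def] at h1
    rwa [div_le_iff₀ (hQbpos x)] at h1
  -- `θ ≤ 1`
  have hθ1 : θ ≤ 1 := by
    rcases eq_or_lt_of_le (mem_Ici.1 hxsX) with hX | hX
    · -- touching at the inflow endpoint `X`: use the datum
      have h1 : θ = |q X| / Qb X := by rw [hθ_def, hg_def, ← hX]
      rw [h1, div_le_one (hQbpos X)]
      simp only [hQb_def, hq_def]
      have : Q₀ ≤ Q := by rw [hQ_def]; linarith [div_nonneg (by linarith : (0:ℝ) ≤ 10 * N) hΛpos.le]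
      linarith [hq0, (Real.exp_pos X).le, mul_nonneg hη'.le (Real.exp_pos X).le]
    · -- interior touching point: the touching lemma for `−q′ = −A₂₂ q − (A₂₁u₁ + g₂)`
      obtain ⟨hS2, hWb, hW'b, hσ, hD, hneg⟩ := hwin xs hxsX
      have hSx := hSpos xs
      set a := W xs; set a' := deriv W xs; set b := S xs; set b' := deriv S xs
      set D : ℝ := (a - 1) ^ 2 - b ^ 2 with hD_def
      have hDpos : 0 < D := by linarith
      obtain ⟨-, hcr⟩ := farField_cramer Λ r a a' b b' (u₁ xs) (deriv u₁ xs) (u₂ xs) (deriv u₂ xs) (f₁ xs) (f₂ xs)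
        hSx.ne' hDpos.ne' (heq xs).1 (heq xs).2
      set A₂₁ : ℝ := (-(1 / 3) * (Λ + r - a' - 2 * a) - (a - 1) * (b' / b + 2)) / D with hA₂₁
      set A₂₂ : ℝ := (2 * (b' / b + 1) * b ^ 2 + (a - 1) * (Λ + r - a' / 3 - 2 * a - (a - 1) * (b' / b))) / D with hA₂₂
      set g₂ : ℝ := 1 / 3 / D * f₁ xs + -(a - 1) / D * (f₂ xs / b) with hg₂
      have hq' : HasDerivAt q ((deriv u₂ xs * b - u₂ xs * b') / b ^ 2) xs := by
        simp only [hq_def]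
        exact (hu₂ xs).hasDerivAt.div (hSd xs).hasDerivAt hSx.ne'
      have hcr' : (deriv u₂ xs * b - u₂ xs * b') / b ^ 2 = A₂₁ * u₁ xs + A₂₂ * q xs + g₂ := by
        rw [hcr]
      obtain ⟨hf1, hf2⟩ := hsrc xs hxsX
      obtain ⟨c22, c21, cg⟩ := farField_q_coeffs (σ := b' / b) hΛ hr1 hr2 hSx hS2 hWb hW'b hσ hD hneg hN.le hf1 hf2
      have hQbd : HasDerivAt Qb (η' * Real.exp xs) xs := by
        simp only [hQb_def]
        simpa using ((Real.hasDerivAt_exp xs).const_mul η').const_add Q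
      have hT := Literature.Analysis.ODE.barrier_touching' (x₁ := X) (x₂ := xs + 1) (xs := xs) (θ := θ)
        (c := fun _ => (-1 : ℝ)) (β := fun _ => -A₂₂) (h := fun _ => A₂₁ * u₁ xs + g₂) (y := q)
        (y' := fun _ => (deriv u₂ xs * b - u₂ xs * b') / b ^ 2) (yb := Qb) (yb' := fun _ => η' * Real.exp xs)
        ⟨hX.le, by linarith⟩ hq' hQbd (fun x _ => hQbpos x) (fun x hx => hle x hx.1)
        (by rw [hθ_def, hg_def, div_mul_cancel₀ _ (hQbpos xs).ne']) (by rw [hcr']; ring)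
        (fun h => absurd h (ne_of_gt hX)) (fun h => by norm_num)
      -- `θ (−A₂₂ Qb + η′ e) ≤ |A₂₁ u₁ + g₂| ≤ (2Λ/3 + 9) A + 4N`
      have hrhs : |A₂₁ * u₁ xs + g₂| ≤ (2 / 3 * Λ + 9) * A + 4 * N := by
        calc _ ≤ |A₂₁ * u₁ xs| + |g₂| := abs_add_le _ _
          _ ≤ (2 / 3 * Λ + 9) * A + 4 * N := by
            rw [abs_mul]
            exact add_le_add (mul_le_mul c21 (hu₁A xs hxsX) (abs_nonneg _) (by positivity)) cg
      have hlhs : θ * ((Λ / 2 - 9 / 2) * Q) ≤ θ * (-A₂₂ * Qb xs - (-1) * (η' * Real.exp xs)) := by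
        apply mul_le_mul_of_nonneg_left _ hθ0
        simp only [hQb_def]
        have h1 : (Λ / 2 - 9 / 2) * Q ≤ -A₂₂ * Q := mul_le_mul_of_nonneg_right c22 hQpos.le
        have h2 : 0 ≤ -A₂₂ * (η' * Real.exp xs) := mul_nonneg (by linarith) (by positivity)
        nlinarith [mul_pos hη' (Real.exp_pos xs)]
      have hkey : θ * ((Λ / 2 - 9 / 2) * Q) ≤ (2 / 3 * Λ + 9) * A + 4 * N := (hlhs.trans hT).trans hrhs
      -- `(Λ/2 − 9/2) Q ≥ (2Λ/3 + 9) A + 4N + (something > 0)`; hence `θ ≤ 1`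
      by_contra hcon
      push Not at hcon
      have hQA : (2 / 3 * Λ + 9) * A + 4 * N < (Λ / 2 - 9 / 2) * Q := by
        rw [hQ_def]
        have h1 : (Λ / 2 - 9 / 2) * (2 * A + 10 * N / Λ + Q₀) =
            Λ * A - 9 * A + (5 * N - 45 * (N / Λ)) + (Λ * Q₀) / 2 - 9 / 2 * Q₀ := by
          field_simp
          ring
        have h2 : N / Λ ≤ N / 100 := div_le_div_of_nonneg_left hN.le (by norm_num) hΛ
        have h3 : 100 * A ≤ Λ * A := mul_le_mul_of_nonneg_right hΛ hA
        have h4 : 100 * Q₀ ≤ Λ * Q₀ := mul_le_mul_of_nonneg_right hΛ hQ₀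
        have e2 : (2 / 3 * Λ + 9) * A = 2 / 3 * (Λ * A) + 9 * A := by ring
        rw [h1, e2]
        linarith
      have hpos : 0 < (Λ / 2 - 9 / 2) * Q := mul_pos (by linarith) hQpos
      have h5 : 1 * ((Λ / 2 - 9 / 2) * Q) < θ * ((Λ / 2 - 9 / 2) * Q) := mul_lt_mul_of_pos_right hcon hpos
      linarith
  -- conclude at `x₀`
  have := hle x₀ hx₀
  simp only [hQb_def] at this
  calc |u₂ x₀ / S x₀| = |q x₀| := rfl
    _ ≤ θ * (Q + η' * Real.exp x₀) := this
    _ ≤ 1 * (Q + η' * Real.exp x₀) := mul_le_mul_of_nonneg_right hθ1 (hQbpos x₀).le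
    _ = 2 * A + 10 * N / Λ + Q₀ + η' * Real.exp x₀ := by rw [one_mul]

end Summit.AtomisticToContinuum.HydrodynamicLimit.Theorems.PackingAnalyticImplosion

end
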